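import Literature.NumberTheory.Automorphic.Liu2021.AppendixC.EtaleBettiComparisonHolds
import Literature.NumberTheory.Automorphic.Liu2021.AppendixC.BettiPinningTransport
import Literature.AlgebraicGeometry.HodgeTheory.AbelianVarietyEndomorphismsHOne
import HarnessLib

/-!
# [Liu 2021, §4.2 / Thm. 4.18 (1)] the `K`-fixed vectors of a pinned Betti tower are the level-`K` classes: `H¹_{B,τ'}(A_∞, ℂ)^K = H¹_{B,τ'}(A_K, ℂ)`
# from descent up to isogeny (row (D)) — the Betti twin of `EtaleHeckeDatumOfTranslates` §3

Topic `NumberTheory/Automorphic/Liu2021/AppendixC`; namespace `Literature.NumberTheory.Automorphic.Liu2021.AppendixC`.  THEOREMS ONLY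
(no definition, no named fact, no instance, no `sorry`).  Continuation of `EtaleBettiComparison` (B-typ04: the hypothesis structure
`Sec42Data.BettiPinning C T τ' H rhoB` — injective, jointly exhaustive level maps `b_K : H¹((A_K ×_{τ'} ℂ)(ℂ); ℂ) → H` with the Hecke law
`rhoB g ∘ b_{K'} = b_K ∘ Alb(T_g)^*`), `EtaleBettiComparisonHolds` (`b_bettiPullAlong_Atr`), `BettiPinningTransport` (`bettiPullAlong_comp/id`),
`RestOneLevelInvariantsHom` (row (D) `HeckeTranslates.IsogenyDescent`: for small `N ⊆ K` normalised by `K`, a `K`-invariant `φ : A_N → B`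
satisfies `Alb_{u^N_K} ≫ ψ = m • φ`, `m ≠ 0`) and `RestOneLevelInvariants` (`C5.SmallLevel.exists_normal_le`).  Written for LINE T5′ of the
cell `hodgecm-mathlib` (D-0151; «CM-Albanese road», A-plan1 (g12) 2026-08-29): the multiplicity-one lever needs the Hecke operators of
`H = H¹_{B,τ'}(A_∞, ℂ)` at level `K` to act on `H¹_{B,τ'}(A_K, ℂ)` itself, i.e. `range b_K = H^K`.

## What is proved (generic over a §4.2 datum `C`, translates `T`, a pinning `B`, and `hD : T.IsogenyDescent`)

* §1 `bettiPullAlong_add` / `_zero` / `_sum` / `_zsmul` — pull-back on `H¹` is ADDITIVE in the homomorphism (`Hom.baseChange_add` + the tree's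
  `complexBetti_map_add_one`: «`ρ_r : Hom(X, X') → Hom_ℤ(Λ, Λ')` is a homomorphism», Lange–Birkenhake §1.1) — the one `H¹`-specific input.
* §2 `exists_bettiPullAlong_Atr_eq_of_isogenyDescent` — **descent of `K`-invariant level-`N` classes**: for `N ⊆ K` normalised by `K` and
  `y ∈ H¹_{B,τ'}(A_N, ℂ)` with `Alb(T_k)^* y = y` (`k ∈ K`), `y = Alb_{u^N_K}^* z` for some `z ∈ H¹_{B,τ'}(A_K, ℂ)`.  Proof = the étale twin
  `exists_dualMap_eq_of_isogenyDescent` word for word: the norm `e := Σ_{q ∈ K/N} Alb(T_q) ∈ End(A_N)` is `K`-invariant, so (D) gives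
  `Alb_u ≫ ψ = m • e`, and `e^* y = [K:N] • y`.
* §3 `exists_b_eq_of_forall_rhoB_eq`, **`range_b_eq_fixedPoints`** — `range b_K = H^K` at EVERY small level `K` («`H¹_{B,τ'}(A_∞, ℂ) :=
  colim_K H¹_{B,τ'}(A_K, ℂ)`» has `K`-invariants `H¹_{B,τ'}(A_K, ℂ)`: [Liu2021, Thm. 4.18 (1) proof l. 2274–2282 with Lem. 2.4 (1)], the
  statement print uses as «`Ω(μ)^K ≃ Hom_E(A_K, A_μ)_ℚ`», l. 2239, read on Betti `H¹`).

HC_CM is proved only modulo the 7 printed citations until rung 0 closes; this file is unconditional and discharges none of them.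

## References
* [Liu2021] Y. Liu, *Fourier–Jacobi cycles and arithmetic relative trace formula*, Camb. J. Math. 9 (2021) = arXiv:2102.11518: §4.2
  (FJcycle.tex l. 2070–2081), Thm. 4.18 (1) with proof (l. 2239, l. 2274–2282), Lem. 2.4 (1).
* [LangeBirkenhake1992] H. Lange, Ch. Birkenhake, *Complex Abelian Varieties* (1992), §1.1 p. 19 (additivity of `f ↦ f^*` on `H¹`; the tree's
  `complexBetti_map_add_one`).
-/

noncomputable section

open CategoryTheory NumberField Function
open scoped TensorProduct

namespace Literature.NumberTheory.Automorphic.Liu2021.AppendixC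

open Literature.AlgebraicGeometry.Motives (AbelianVariety)
open Literature.AlgebraicGeometry.HodgeTheory (complexBetti complexBetti_map_add_one complexBetti_map_zero_one)

/-! ## §1 Additivity of `bettiPullAlong` in the homomorphism -/

section Additive

variable {E : Type} [Field E] (τ' : E →+* ℂ) {A A' : AbelianVariety E}

/-- **`(f + g)^* = f^* + g^*` on `H¹_{B,τ'}`**: base change along `τ'` is additive (`Hom.baseChange_add`) and homomorphisms of complex
abelian varieties act additively on `H¹` (`complexBetti_map_add_one`). [cite: LangeBirkenhake1992, §1.1 (p. 19)] [cite: Liu2021, §4.2 l. 2070–2079] -/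
theorem bettiPullAlong_add (f g : A ⟶ A') : bettiPullAlong τ' (f + g) = bettiPullAlong τ' f + bettiPullAlong τ' g := by
  letI : Algebra E ℂ := algebraAlong E τ'
  rw [bettiPullAlong_eq_complexBetti_map, bettiPullAlong_eq_complexBetti_map, bettiPullAlong_eq_complexBetti_map,
    AbelianVariety.Hom.baseChange_add, complexBetti_map_add_one, ModuleCat.hom_add]

/-- `0^* = 0` on `H¹_{B,τ'}`. [cite: LangeBirkenhake1992, §1.1 (p. 19)] -/
theorem bettiPullAlong_zero : bettiPullAlong τ' (0 : A ⟶ A') = 0 := by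
  have h := bettiPullAlong_add τ' (0 : A ⟶ A') 0
  rw [add_zero] at h
  exact left_eq_add.1 h

/-- `(Σ_i f_i)^* = Σ_i f_i^*` on `H¹_{B,τ'}`. [cite: LangeBirkenhake1992, §1.1 (p. 19)] -/
theorem bettiPullAlong_sum {ι : Type*} (s : Finset ι) (f : ι → (A ⟶ A')) :
    bettiPullAlong τ' (∑ i ∈ s, f i) = ∑ i ∈ s, bettiPullAlong τ' (f i) := by
  classical
  induction s using Finset.induction_on with
  | empty => rw [Finset.sum_empty, Finset.sum_empty, bettiPullAlong_zero]
  | insert i s hi ih => rw [Finset.sum_insert hi, Finset.sum_insert hi, bettiPullAlong_add, ih]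

/-- `(m • f)^* = m • f^*` on `H¹_{B,τ'}` for `m ∈ ℤ`. [cite: LangeBirkenhake1992, §1.1 (p. 19)] -/
theorem bettiPullAlong_zsmul (m : ℤ) (f : A ⟶ A') : bettiPullAlong τ' (m • f) = m • bettiPullAlong τ' f := by
  let Φ : (A ⟶ A') →+ (bettiH1Along A' τ' →ₗ[ℂ] bettiH1Along A τ') :=
    AddMonoidHom.mk' (fun f => bettiPullAlong τ' f) (bettiPullAlong_add τ')
  exact map_zsmul Φ m f

end Additive

/-! ## §2 Descent of `K`-invariant classes along `Alb_{u^N_K}` from `IsogenyDescent` -/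

variable {F E : Type} [Field F] [NumberField F] [IsTotallyReal F] [Field E] [NumberField E] [Algebra F E]
  [IsTotallyComplex E] [Algebra.IsQuadraticExtension F E]
variable {P5 : PropC5Data F E} {isotropicAt : ℕ → Prop}

namespace Sec42Data.HeckeTranslates

variable {C : Sec42Data P5 isotropicAt} (T : C.HeckeTranslates) (τ' : E →+* ℂ)

/-- **Descent of invariant Betti classes, from descent up to isogeny.**  For small levels `N ⊆ K` with `N` normalised by `K` and a
class `y ∈ H¹_{B,τ'}(A_N, ℂ)` with `Alb(T_k)^* y = y` for all `k ∈ K`, `y` is pulled back from `H¹_{B,τ'}(A_K, ℂ)` along `Alb_{u^N_K}`.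
Proof: `K/N` is finite (`N` open in the compact `K`); the norm `e := Σ_{q ∈ K/N} Alb(T_q) ∈ End(A_N)` is `K`-invariant (`Alb T_k ≫ Alb T_q
= Alb T_{kq}`, `Alb T_n = 𝟙` for `n ∈ N`), so `IsogenyDescent` gives `Alb_u ≫ ψ = m • e` with `m ≠ 0`; then `Alb_u^* (ψ^* y) = m • e^* y =
m·[K:N] • y` (additivity of `f ↦ f^*` on `H¹`).  The Betti twin of `exists_dualMap_eq_of_isogenyDescent`.
[cite: Liu2021, Thm. 4.18 (1) (FJcycle.tex l. 2239, l. 2274–2282) and Lem. 2.4 (1)] -/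
theorem exists_bettiPullAlong_Atr_eq_of_isogenyDescent (hD : T.IsogenyDescent) {N K : C5.SmallLevel C.S.K₀} (hNK : N ≤ K)
    (hn : ∀ k ∈ K.1.1, C5.HeckeLE k N N) (y : C.bettiH1 τ' N)
    (hinv : ∀ (k : C.G) (hk : k ∈ K.1.1), bettiPullAlong τ' (T.albTr k N N (hn k hk)) y = y) :
    ∃ z : C.bettiH1 τ' K, bettiPullAlong τ' (C.Atr (homOfLE hNK)) z = y := by
  -- the finite quotient `K / N`
  haveI : CompactSpace K.1.1 := isCompact_iff_compactSpace.1 K.1.2.2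
  let N' : Subgroup K.1.1 := N.1.1.subgroupOf K.1.1
  haveI : Finite (K.1.1 ⧸ N') :=
    Subgroup.quotient_finite_of_isOpen N' (N.1.2.1.preimage continuous_subtype_val)
  letI : Fintype (K.1.1 ⧸ N') := Fintype.ofFinite _
  -- the translates as a function on `K / N`
  let a : K.1.1 ⧸ N' → (C.A N ⟶ C.A N) := fun q => T.albTr (q.out : C.G) N N (hn _ q.out.2)
  have ha : ∀ (k : C.G) (hk : k ∈ K.1.1),
      T.albTr k N N (hn k hk) = a (QuotientGroup.mk (⟨k, hk⟩ : K.1.1)) := by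
    intro k hk
    obtain ⟨n, hkn⟩ := QuotientGroup.mk_out_eq_mul N' (⟨k, hk⟩ : K.1.1)
    have hnN : ((n : K.1.1) : C.G) ∈ N.1.1 := Subgroup.mem_subgroupOf.1 n.2
    have e1 : a (QuotientGroup.mk (⟨k, hk⟩ : K.1.1)) =
        T.albTr (k * ((n : K.1.1) : C.G)) N N ((hn k hk).mul (C5.HeckeLE.of_mem hnN)) :=
      T.albTr_congr (congrArg Subtype.val hkn) _ _
    rw [e1, ← T.albTr_mul k _ (hn k hk) (C5.HeckeLE.of_mem hnN), T.albTr_self hnN, Category.comp_id]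
  have hka : ∀ (k : C.G) (hk : k ∈ K.1.1) (q : K.1.1 ⧸ N'),
      T.albTr k N N (hn k hk) ≫ a q = a ((⟨k, hk⟩ : K.1.1) • q) := by
    intro k hk q
    have e1 : T.albTr k N N (hn k hk) ≫ a q =
        T.albTr (k * (q.out : C.G)) N N (hn _ ((⟨k, hk⟩ : K.1.1) * q.out).2) :=
      (T.albTr_mul _ _ _ _).trans (T.albTr_congr rfl _ _)
    rw [e1, ha (k * (q.out : C.G)) ((⟨k, hk⟩ : K.1.1) * q.out).2, ← MulAction.Quotient.mk_smul_out N' (⟨k, hk⟩ : K.1.1) q]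
    rfl
  -- the norm endomorphism and its invariance
  let e : C.A N ⟶ C.A N := ∑ q, a q
  have he : ∀ (k : C.G) (hk : k ∈ K.1.1), T.albTr k N N (hn k hk) ≫ e = e := by
    intro k hk
    show T.albTr k N N (hn k hk) ≫ ∑ q, a q = ∑ q, a q
    rw [Preadditive.comp_sum]
    exact (Finset.sum_congr rfl fun q _ => hka k hk q).trans
      (Equiv.sum_comp (MulAction.toPerm (⟨k, hk⟩ : K.1.1)) a)
  obtain ⟨m, ψ, hm, hψ⟩ := hD hNK hn (C.A N) e he
  -- `f ↦ f^*` is additive on `H¹`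
  have hVe : bettiPullAlong τ' e y = (Fintype.card (K.1.1 ⧸ N') : ℂ) • y := by
    show bettiPullAlong τ' (∑ q, a q) y = _
    rw [bettiPullAlong_sum, LinearMap.sum_apply]
    have h2 : ∀ q, bettiPullAlong τ' (a q) y = y := fun q => hinv (q.out : C.G) q.out.2
    simp_rw [h2]
    rw [Finset.sum_const, Finset.card_univ, ← Nat.cast_smul_eq_nsmul ℂ]
  have hVψ : bettiPullAlong τ' (C.Atr (homOfLE hNK)) ∘ₗ bettiPullAlong τ' ψ = m • bettiPullAlong τ' e := by
    rw [← bettiPullAlong_comp, hψ, bettiPullAlong_zsmul]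
  have hm' : (m : ℂ) ≠ 0 := Int.cast_ne_zero.2 hm
  have hc : (Fintype.card (K.1.1 ⧸ N') : ℂ) ≠ 0 := Nat.cast_ne_zero.2 Fintype.card_ne_zero
  refine ⟨((m : ℂ) * Fintype.card (K.1.1 ⧸ N'))⁻¹ • bettiPullAlong τ' ψ y, ?_⟩
  rw [map_smul, ← LinearMap.comp_apply, hVψ, LinearMap.smul_apply, hVe, ← Int.cast_smul_eq_zsmul ℂ m, smul_smul, smul_smul,
    mul_assoc, inv_mul_cancel₀ (mul_ne_zero hm' hc), one_smul]

end Sec42Data.HeckeTranslates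

/-! ## §3 `range b_K = H^K`: the `K`-fixed vectors of the pinned tower are the level-`K` classes -/

namespace Sec42Data.BettiPinning

variable {C : Sec42Data P5 isotropicAt} {T : C.HeckeTranslates} {τ' : E →+* ℂ} {H : Type} [AddCommGroup H] [Module ℂ H]
  {rhoB : Representation ℂ C.G H} (B : C.BettiPinning T τ' H rhoB)

/-- Level-`K` classes are `K`-fixed: `rhoB k (b_K y) = b_K y` for `k ∈ K` (`Alb(T_k) = 𝟙`). [cite: Liu2021, §4.2 l. 2070–2081] -/
theorem rhoB_b_eq_of_mem {K : C5.SmallLevel C.S.K₀} {k : C.G} (hk : k ∈ K.1.1) (y : C.bettiH1 τ' K) :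
    rhoB k (B.b K y) = B.b K y := by
  rw [B.rhoB_apply_b_of_mem hk y, T.albTr_self hk, bettiPullAlong_id_apply]

/-- **Every `K`-fixed vector of `H` is a level-`K` class**, granted descent up to isogeny (row (D)): a vector lives at some level
(`exhaust`); refine to a level `N ⊆ K` normalised by `K` (`C5.SmallLevel.exists_normal_le`); `K`-invariance in `H` is `K`-invariance of
the level-`N` representative (`b_N` injective + the Hecke law); descend to `K` by `exists_bettiPullAlong_Atr_eq_of_isogenyDescent` and
`b_N ∘ Alb_u^* = b_K`.  The Betti twin of `range_toTower_eq_of_isogenyDescent`. [cite: Liu2021, Thm. 4.18 (1) (FJcycle.tex l. 2239) and §4.2 l. 2079–2081] -/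
theorem exists_b_eq_of_forall_rhoB_eq (hD : T.IsogenyDescent) (K : C5.SmallLevel C.S.K₀) {x : H}
    (hx : ∀ k ∈ K.1.1, rhoB k x = x) : ∃ y : C.bettiH1 τ' K, B.b K y = x := by
  obtain ⟨K₁, y₀, hy₀⟩ := B.exhaust x
  obtain ⟨N, hNK, hNK₁, hN⟩ := C5.SmallLevel.exists_normal_le K K₁
  -- move the representative to the level `N`
  set y : C.bettiH1 τ' N := bettiPullAlong τ' (C.Atr (homOfLE hNK₁)) y₀ with hy
  have hxy : B.b N y = x := by rw [hy, B.b_bettiPullAlong_Atr, hy₀]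
  -- invariance at level `N`
  have hinv : ∀ (k : C.G) (hk : k ∈ K.1.1), bettiPullAlong τ' (T.albTr k N N (hN k hk)) y = y := by
    intro k hk
    apply B.b_injective N
    rw [← B.b_hecke k N N (hN k hk) y, hxy]
    exact hx k hk
  obtain ⟨z, hz⟩ := T.exists_bettiPullAlong_Atr_eq_of_isogenyDescent τ' hD hNK hN y hinv
  refine ⟨z, ?_⟩
  rw [← hxy, ← hz, B.b_bettiPullAlong_Atr]

/-- **`range b_K = H^K`** (as submodules of `H`): the level-`K` classes are exactly the `K`-fixed vectors of the pinned Betti tower, for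
EVERY sufficiently small level `K`, granted `T.IsogenyDescent` — «`H¹_{B,τ'}(A_∞, ℂ)^K = H¹_{B,τ'}(A_K, ℂ)`».
[cite: Liu2021, Thm. 4.18 (1) (FJcycle.tex l. 2239, l. 2274–2282); §4.2 l. 2079–2081; Lem. 2.4 (1)] -/
theorem range_b_eq_fixedPoints (hD : T.IsogenyDescent) (K : C5.SmallLevel C.S.K₀) :
    LinearMap.range (B.b K) = rhoB.fixedPoints K.1.1 := by
  ext x
  rw [LinearMap.mem_range, Representation.mem_fixedPoints]
  constructor
  · rintro ⟨y, rfl⟩ k hk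
    exact B.rhoB_b_eq_of_mem hk y
  · exact fun hx => B.exists_b_eq_of_forall_rhoB_eq hD K hx

/-- the level-`K` classes are `K`-fixed (the inclusion `range b_K ≤ H^K`, unconditionally). [cite: Liu2021, §4.2 l. 2079–2081] -/
theorem b_mem_fixedPoints (K : C5.SmallLevel C.S.K₀) (y : C.bettiH1 τ' K) : B.b K y ∈ rhoB.fixedPoints K.1.1 :=
  (rhoB.mem_fixedPoints K.1.1 (B.b K y)).2 fun _ hk => B.rhoB_b_eq_of_mem hk y

end Sec42Data.BettiPinning

end Literature.NumberTheory.Automorphic.Liu2021.AppendixC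

end
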